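import Literature.Topology.FourManifolds.NormalRetraction
import Mathlib.Geometry.Manifold.WhitneyEmbedding
import Mathlib.Geometry.Manifold.SmoothApprox
import Mathlib.Topology.MetricSpace.Thickening
import HarnessLib

/-!
# Smoothing a continuous map into a compact manifold, relative to a closed set and preserving
# finitely many open constraints

Topic `Literature/Topology/FourManifolds`; general infrastructure (companion of
`HomotopySmoothing.lean`), used by the tree's proof of the arc-closing lemma of Milnor's proof of
Lemma 8.3 (`Milnor1965_exists_embedding_circle_through_arc`, `HCobordismIdealCircleLemma83.lean`).

* `Literature.Topology.FourManifolds.exists_contMDiff_eqOn_mapsTo` — let `M` be a σ-compact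
  Hausdorff manifold, `V` a compact Hausdorff manifold without boundary modelled on `ℝⁿ`, and
  `f : M → V` continuous, smooth on an open `W ⊇ S` with `S` closed, mapping finitely many
  compact sets `C i` into open sets `U i`.  Then there is a smooth `g : M → V` with `g = f` on
  `S` and `g (C i) ⊆ U i` for all `i`.

**Proof** (Hirsch, *Differential Topology* (1976), Ch. 2 §2 Thm. 2.6 "relative approximation"
with Ch. 4 §5).  Embed `V ⊆ ℝᴺ` (Mathlib's `exists_embedding_euclidean_of_compact`) with a smooth
normal retraction `r : T → V` of an open tube (the tree's
`Literature.Topology.FourManifolds.exists_normalRetraction`); approximate `e ∘ f` uniformly,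
within the tube margin and within the margins of the open sets `{y ∈ T | r y ∈ U i}` about the
compact sets `e (f (C i))`, by a smooth map unchanged on `S` (Mathlib's
`Continuous.exists_contMDiff_approx_and_eqOn`); retract.  Everything here is proved; no
definitions, no named facts.

## References

* M. W. Hirsch, *Differential Topology*, GTM 33 (1976), Ch. 2 §2 (Thm. 2.6), Ch. 4 §5.
  [HirschDT1976]
-/

open scoped Manifold ContDiff Topology
open Function Set Filter

noncomputable section

namespace Literature.Topology.FourManifolds

/-- **Relative smoothing with open constraints.**  Let `M` be a σ-compact Hausdorff `C^∞`
manifold (finite-dimensional model), `V` a compact Hausdorff manifold without boundary modelled on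
`ℝⁿ`, `f : M → V` continuous and `C^∞` on an open set `W` containing the closed set `S`, and
`C i ⊆ M` finitely many compact sets with `f (C i) ⊆ U i`, `U i` open.  Then some smooth
`g : M → V` agrees with `f` on `S` and still maps each `C i` into `U i`.
[cite: HirschDT1976, Ch. 2 §2 Thm. 2.6 and Ch. 4 §5] -/
theorem exists_contMDiff_eqOn_mapsTo {EM HM : Type*} [NormedAddCommGroup EM] [NormedSpace ℝ EM]
    [FiniteDimensional ℝ EM] [TopologicalSpace HM] {IM : ModelWithCorners ℝ EM HM} {M : Type*}
    [TopologicalSpace M] [ChartedSpace HM M] [IsManifold IM ∞ M] [SigmaCompactSpace M]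
    [T2Space M] {n : ℕ} {V : Type*} [TopologicalSpace V]
    [ChartedSpace (EuclideanSpace ℝ (Fin n)) V] [IsManifold (𝓡 n) ∞ V] [CompactSpace V]
    [T2Space V] {f : M → V} (hf : Continuous f) {S W : Set M} (hS : IsClosed S) (hW : IsOpen W)
    (hSW : S ⊆ W) (hfW : ContMDiffOn IM (𝓡 n) ∞ f W) {ι : Type*} [Finite ι] {C : ι → Set M}
    {U : ι → Set V} (hC : ∀ i, IsCompact (C i)) (hU : ∀ i, IsOpen (U i))
    (hCU : ∀ i, MapsTo f (C i) (U i)) :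
    ∃ g : M → V, ContMDiff IM (𝓡 n) ∞ g ∧ EqOn g f S ∧ ∀ i, MapsTo g (C i) (U i) := by
  rcases isEmpty_or_nonempty M with hM | hM
  · exact ⟨f, fun x => (IsEmpty.false x).elim, fun x _ => rfl, fun i => hCU i⟩
  haveI : Nonempty V := ⟨f (Classical.arbitrary M)⟩
  -- ### Whitney embedding of `V` and a smooth normal retraction
  obtain ⟨N, e, he, hemb, hinj⟩ := exists_embedding_euclidean_of_compact (I := 𝓡 n) (M := V)
  obtain ⟨ε, hε, hTopen, hr, hre⟩ := exists_normalRetraction (I := 𝓡 n) he hemb.injective hinj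
  set T := normalTube (𝓡 n) e ε with hTdef
  set r := normalRetraction (𝓡 n) e ε with hrdef
  have hreT : ∀ y : V, e y ∈ T ∧ r (e y) = y := fun y => by
    simpa [hTdef, hrdef] using hre y 0 (Submodule.zero_mem _) (by simpa using hε)
  -- ### the map read in `ℝᴺ`
  set F : M → EuclideanSpace ℝ (Fin N) := fun p => e (f p) with hF
  have hFc : Continuous F := he.continuous.comp hf
  have hFW : ContMDiffOn IM 𝓘(ℝ, EuclideanSpace ℝ (Fin N)) ∞ F W := he.comp_contMDiffOn hfW
  -- ### margins
  obtain ⟨δ₀, hδ₀, hδ₀T⟩ := (isCompact_range he.continuous).exists_cthickening_subset_open hTopen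
    (range_subset_iff.2 fun y => (hreT y).1)
  have hOi : ∀ i, IsOpen (T ∩ r ⁻¹' U i) := fun i =>
    hr.continuousOn.isOpen_inter_preimage hTopen (hU i)
  have hδi : ∀ i, ∃ δ : ℝ, 0 < δ ∧ Metric.cthickening δ (F '' C i) ⊆ T ∩ r ⁻¹' U i := fun i =>
    ((hC i).image hFc).exists_cthickening_subset_open (hOi i) (by
      rintro _ ⟨p, hp, rfl⟩
      exact ⟨(hreT (f p)).1, by
        change r (e (f p)) ∈ U i
        rw [(hreT (f p)).2]
        exact hCU i hp⟩)
  choose δi hδi_pos hδiP using hδi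
  obtain ⟨δ, ⟨hδle0, hδlei⟩, hδpos⟩ : ∃ δ : ℝ, (δ ≤ δ₀ ∧ ∀ i, δ ≤ δi i) ∧ 0 < δ := by
    have h1 : ∀ᶠ δ in 𝓝[>] (0 : ℝ), δ ≤ δ₀ := by
      filter_upwards [Ioc_mem_nhdsGT hδ₀] with δ hδ using hδ.2
    have h2 : ∀ᶠ δ in 𝓝[>] (0 : ℝ), ∀ i, δ ≤ δi i :=
      eventually_all.2 fun i => by
        filter_upwards [Ioc_mem_nhdsGT (hδi_pos i)] with δ hδ using hδ.2
    exact ((h1.and h2).and self_mem_nhdsWithin).exists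
  -- ### smooth approximation relative to `S`
  obtain ⟨g, hgF, hgS, -⟩ := hFc.exists_contMDiff_approx_and_eqOn IM ⊤ continuous_const
    (fun _ => hδpos) hS (hW.mem_nhdsSet.2 hSW) hFW
  have hgT : ∀ p, g p ∈ T := fun p =>
    hδ₀T (Metric.mem_cthickening_of_dist_le _ (F p) _ _ ⟨f p, rfl⟩ ((hgF p).le.trans hδle0))
  refine ⟨fun p => r (g p), hr.comp_contMDiff g.contMDiff hgT, fun p hp => ?_, fun i p hp => ?_⟩
  · change r (g p) = f p
    rw [hgS hp]
    exact (hreT (f p)).2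
  · have hmem : g p ∈ Metric.cthickening (δi i) (F '' C i) :=
      Metric.mem_cthickening_of_dist_le _ (F p) _ _ ⟨p, hp, rfl⟩ ((hgF p).le.trans (hδlei i))
    exact (hδiP i hmem).2

end Literature.Topology.FourManifolds
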